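import Summits.AnomalousDissipation.AnomalousDissipation.Theorems.MarginalStabilityChainStrainedLayerLawSumRuleLine
import Mathlib.Analysis.Calculus.Deriv.MeanValue
import Mathlib.Analysis.Real.Sqrt
import Mathlib.MeasureTheory.Integral.IntervalIntegral.Basic
import Mathlib.Topology.Order.Monotone

/-!
# Stub `stub_vorticityUniformBounds` (crux stmt-AnomalousDissipation-3007, line `strain-work-sum-rule`) — tools A:
# the real-variable skeleton of the a-priori chain (barrier principle, Riccati and confinement comparisons)

Support file (`--supports stmt-AnomalousDissipation-3007`; registered sub-goals
`stub_vorticityUniformBounds_riccati`, `stub_vorticityUniformBounds_confinement`). The stub asks, at FIXED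
viscosity, for uniform-in-time (`t ≥ 1`) bounds on `∫∫|ω|`, `∫∫ω²`, `∫∫|y||ω|` over one period cell of a
classical solution of the stretched two-dimensional Navier–Stokes layer system. Behind it is the chain
(a) Kato `L¹`-antitonicity of the conservation form `∂ₜω + div(ω(u, v − y)) = νΔω`,
(c′) the enstrophy law `½Ω′ = ½Ω − ν‖∇ω‖²` plus a Nash inequality on the cylinder, giving the RICCATI
differential inequality `Ω′ ≤ αΩ − βΩ²`, and (b′) the moment law
`m′ ≤ −2m + a√m + b` for `m = ∫∫ y²|ω|` (compression by the strain, Ladyzhenskaya for the `yv|ω|` term).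
This file banks the REAL-VARIABLE half of (c′) and (b′), in three interchangeable forms each (superlevel
intervals / derivative / integral), all consequences of one BARRIER PRINCIPLE:

* `stub_vorticityUniformBounds_barrier`: if `f` is continuous on `[t₀, ∞)` and does not increase across any
  compact interval `[s, t] ⊂ (t₀, ∞)` on which `f > K`, then `f t ≤ max (f t₀) K` for all `t ≥ t₀`
  (the last time `c ≤ t` with `f c ≤ max (f t₀) K` exists by continuity; letting `s ↓ c` in `f t ≤ f s` gives the
  contradiction); derivative form `…_barrier_of_hasDerivAt` (`f′ < 0` wherever `f > K`, mean value theorem) and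
  integral form `…_barrier_of_integral` (`f t − f s ≤ ∫ₛᵗ g` with `g < 0` wherever `f > K`);
* `stub_vorticityUniformBounds_riccati` (`Ω′ ≤ αΩ − βΩ²`, `α ≥ 0`, `β > 0` ⇒ `Ω ≤ max (Ω t₀) (α/β)`) and its
  integral form `…_riccati_integral`;
* `stub_vorticityUniformBounds_confinement` (`m′ ≤ −2m + a√m + b`, `b ≥ 0` ⇒ `m ≤ max (m t₀) (a²/4 + b)`, by
  `a√m ≤ m + a²/4`) and its integral form `…_confinement_integral`.

References: standard ODE comparison (e.g. the Riccati step of the 2-D enstrophy bound, C. R. Doering,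
J. D. Gibbon, *Applied Analysis of the Navier–Stokes Equations*, CUP 1995, §7.2). All `[folklore]`.
-/

-- `Summit.<Summit>.<Problem>` is the tree's mandated summit-side namespace (CONVENTIONS §2); for this
-- single-conjunct summit the two coincide, so the duplicate is deliberate.
set_option linter.dupNamespace false

noncomputable section

open scoped Topology ENNReal
open Filter Set Function MeasureTheory

namespace Summit.AnomalousDissipation.AnomalousDissipation.Theorems.StrainedLayerLaw.StrainWorkSumRule

open Literature.Analysis.FluidPDE Literature.Analysis.FluidPDE.StretchedLayer

/-! ## The barrier principle -/

/-- **Barrier principle (superlevel-interval form).** Let `f` be continuous on `[t₀, ∞)` and suppose that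
`f t ≤ f s` whenever `t₀ < s < t` and `f > K` on `[s, t]`. Then `f t ≤ max (f t₀) K` for every `t ≥ t₀`.
(If `f t > K′ := max (f t₀) K`, the set of `r ∈ [t₀, t]` with `f r ≤ K′` is closed, nonempty and has a
supremum `c < t` with `f c ≤ K′`; on `(c, t]`, `f > K′ ≥ K`, so `f t ≤ f s` for all `s ∈ (c, t)`, and
`s ↓ c` gives `f t ≤ f c ≤ K′`.) [folklore] -/
theorem stub_vorticityUniformBounds_barrier {f : ℝ → ℝ} {t₀ K t : ℝ} (hcont : ContinuousOn f (Ici t₀))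
    (hmono : ∀ s t : ℝ, t₀ < s → s < t → (∀ r ∈ Icc s t, K < f r) → f t ≤ f s) (ht : t₀ ≤ t) :
    f t ≤ max (f t₀) K := by
  by_contra hlt
  push Not at hlt
  set K' : ℝ := max (f t₀) K with hK'
  set S : Set ℝ := Icc t₀ t ∩ f ⁻¹' Iic K' with hS
  have hSclosed : IsClosed S :=
    (hcont.mono Icc_subset_Ici_self).preimage_isClosed_of_isClosed isClosed_Icc isClosed_Iic
  have ht₀S : t₀ ∈ S := ⟨left_mem_Icc.2 ht, show f t₀ ≤ K' from le_max_left _ _⟩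
  have hSbdd : BddAbove S := ⟨t, fun s hs => hs.1.2⟩
  set c : ℝ := sSup S with hc
  have hcS : c ∈ S := hSclosed.csSup_mem ⟨t₀, ht₀S⟩ hSbdd
  have hfc : f c ≤ K' := hcS.2
  have hct : c < t := by
    rcases lt_or_eq_of_le hcS.1.2 with h | h
    · exact h
    · exact absurd (h ▸ hfc) (not_le.2 hlt)
  -- on `(c, t]`, `f > K'`
  have habove : ∀ s ∈ Ioc c t, K' < f s := by
    intro s hs
    by_contra hle
    push Not at hle
    have hsS : s ∈ S := ⟨⟨hcS.1.1.trans hs.1.le, hs.2⟩, show f s ≤ K' from hle⟩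
    exact (not_le.2 hs.1) (le_csSup hSbdd hsS)
  -- hence `f t ≤ f s` for every `s ∈ (c, t)`
  have hts : ∀ s ∈ Ioo c t, f t ≤ f s := by
    intro s hs
    refine hmono s t (lt_of_le_of_lt hcS.1.1 hs.1) hs.2 fun r hr => ?_
    exact (le_max_right _ _).trans_lt (habove r ⟨hs.1.trans_le hr.1, hr.2⟩)
  -- let `s ↓ c`: `f t ≤ f c`
  have hlim : Tendsto f (𝓝[>] c) (𝓝 (f c)) := by
    have h1 : ContinuousWithinAt f (Ici t₀) c := hcont c hcS.1.1
    have h2 : ContinuousWithinAt f (Ioi c) c := h1.mono fun r hr => (hcS.1.1.trans (le_of_lt hr) : t₀ ≤ r)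
    exact h2.tendsto
  have hev : ∀ᶠ s in 𝓝[>] c, f t ≤ f s := by
    filter_upwards [Ioo_mem_nhdsGT hct] with s hs using hts s hs
  have hle : f t ≤ f c := ge_of_tendsto hlim hev
  exact (not_le.2 hlt) (hle.trans hfc)

/-- **Barrier principle, derivative form**: if `f` is continuous on `[t₀, ∞)` and at every `s > t₀` with
`f s > K` it has a derivative `D < 0`, then `f t ≤ max (f t₀) K` for `t ≥ t₀` (mean value theorem on the
superlevel intervals). [folklore] -/
theorem stub_vorticityUniformBounds_barrier_of_hasDerivAt {f : ℝ → ℝ} {t₀ K t : ℝ}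
    (hcont : ContinuousOn f (Ici t₀))
    (hderiv : ∀ s : ℝ, t₀ < s → K < f s → ∃ D : ℝ, HasDerivAt f D s ∧ D < 0) (ht : t₀ ≤ t) :
    f t ≤ max (f t₀) K := by
  refine stub_vorticityUniformBounds_barrier hcont (fun s t hs hst habove => ?_) ht
  choose! D hD using hderiv
  have hcont' : ContinuousOn f (Icc s t) := hcont.mono fun r hr => (hs.le.trans hr.1 : t₀ ≤ r)
  have hdiff : ∀ r ∈ Ioo s t, HasDerivAt f (D r) r := fun r hr =>
    (hD r (hs.trans hr.1) (habove r (Ioo_subset_Icc_self hr))).1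
  obtain ⟨ξ, hξ, hslope⟩ := exists_hasDerivAt_eq_slope f D hst hcont' hdiff
  have hneg : D ξ < 0 := (hD ξ (hs.trans hξ.1) (habove ξ (Ioo_subset_Icc_self hξ))).2
  rw [hslope, div_neg_iff] at hneg
  rcases hneg with ⟨_, h⟩ | ⟨h, _⟩
  · linarith
  · linarith

/-- **Barrier principle, integral form**: if `f`, `g` are continuous on `[t₀, ∞)`,
`f t − f s ≤ ∫ₛᵗ g` for `t₀ < s < t`, and `g < 0` wherever `f > K` (beyond `t₀`), then
`f t ≤ max (f t₀) K` for `t ≥ t₀`. [folklore] -/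
theorem stub_vorticityUniformBounds_barrier_of_integral {f g : ℝ → ℝ} {t₀ K t : ℝ}
    (hcont : ContinuousOn f (Ici t₀)) (hg : ContinuousOn g (Ici t₀))
    (hint : ∀ s t : ℝ, t₀ < s → s < t → f t - f s ≤ ∫ r in s..t, g r)
    (hneg : ∀ s : ℝ, t₀ < s → K < f s → g s < 0) (ht : t₀ ≤ t) :
    f t ≤ max (f t₀) K := by
  refine stub_vorticityUniformBounds_barrier hcont (fun s t hs hst habove => ?_) ht
  have hgi : IntervalIntegrable (fun r => -g r) volume s t := by
    refine (ContinuousOn.intervalIntegrable ?_).neg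
    rw [uIcc_of_le hst.le]
    exact hg.mono fun r hr => (hs.le.trans hr.1 : t₀ ≤ r)
  have hpos : 0 < ∫ r in s..t, -g r :=
    intervalIntegral.intervalIntegral_pos_of_pos_on hgi
      (fun r hr => neg_pos.2 (hneg r (hs.trans hr.1) (habove r (Ioo_subset_Icc_self hr)))) hst
  rw [intervalIntegral.integral_neg] at hpos
  linarith [hint s t hs hst]

/-! ## The Riccati comparison of the enstrophy step -/

/-- The Riccati right-hand side is negative above the threshold: `α ≥ 0`, `β > 0`, `Ω > α/β` ⇒
`αΩ − βΩ² < 0`. [folklore] -/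
theorem stub_vorticityUniformBounds_riccati_rhs_neg {α β Ω : ℝ} (hα : 0 ≤ α) (hβ : 0 < β)
    (hΩ : α / β < Ω) : α * Ω - β * Ω ^ 2 < 0 := by
  have hpos : 0 < Ω := lt_of_le_of_lt (div_nonneg hα hβ.le) hΩ
  have h1 : α < β * Ω := by
    rw [div_lt_iff₀ hβ] at hΩ
    linarith [mul_comm Ω β]
  nlinarith [mul_pos hpos (sub_pos.2 h1)]

/-- **Riccati comparison (derivative form; registered sub-goal).** If `Ω` is continuous on `[t₀, ∞)` and at
every `t > t₀` has a derivative `D ≤ αΩ(t) − βΩ(t)²` with `α ≥ 0`, `β > 0`, then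
`Ω t ≤ max (Ω t₀) (α/β)` for all `t ≥ t₀` — the real-variable step of the enstrophy bound
(`½Ω′ = ½Ω − ν‖∇ω‖²` and Nash `‖∇ω‖₂² ≳ Ω²/‖ω‖₁²`). [folklore] -/
theorem stub_vorticityUniformBounds_riccati : ∀ (α β t₀ : ℝ) (Ω : ℝ → ℝ), 0 ≤ α → 0 < β →
    ContinuousOn Ω (Ici t₀) →
    (∀ t : ℝ, t₀ < t → ∃ D : ℝ, HasDerivAt Ω D t ∧ D ≤ α * Ω t - β * Ω t ^ 2) →
      ∀ t : ℝ, t₀ ≤ t → Ω t ≤ max (Ω t₀) (α / β) := by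
  intro α β t₀ Ω hα hβ hcont hderiv t ht
  refine stub_vorticityUniformBounds_barrier_of_hasDerivAt hcont (fun s hs hK => ?_) ht
  obtain ⟨D, hD, hle⟩ := hderiv s hs
  exact ⟨D, hD, hle.trans_lt (stub_vorticityUniformBounds_riccati_rhs_neg hα hβ hK)⟩

/-- **Riccati comparison (integral form).** If `Ω` is continuous on `[t₀, ∞)` and
`Ω t − Ω s ≤ ∫ₛᵗ (αΩ − βΩ²)` for `t₀ < s < t`, with `α ≥ 0`, `β > 0`, then `Ω t ≤ max (Ω t₀) (α/β)` for
`t ≥ t₀`. [folklore] -/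
theorem stub_vorticityUniformBounds_riccati_integral {α β t₀ : ℝ} {Ω : ℝ → ℝ} (hα : 0 ≤ α) (hβ : 0 < β)
    (hcont : ContinuousOn Ω (Ici t₀))
    (hint : ∀ s t : ℝ, t₀ < s → s < t → Ω t - Ω s ≤ ∫ r in s..t, (α * Ω r - β * Ω r ^ 2)) {t : ℝ}
    (ht : t₀ ≤ t) : Ω t ≤ max (Ω t₀) (α / β) := by
  refine stub_vorticityUniformBounds_barrier_of_integral hcont ?_ hint
    (fun s _ hK => stub_vorticityUniformBounds_riccati_rhs_neg hα hβ hK) ht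
  exact ((continuousOn_const.mul hcont).sub (continuousOn_const.mul (hcont.pow 2)))

/-! ## The linear confinement comparison of the moment step -/

/-- The confinement right-hand side is negative above the threshold: `b ≥ 0`, `m > a²/4 + b` ⇒
`−2m + a√m + b < 0` (since `a√m ≤ m + a²/4`). [folklore] -/
theorem stub_vorticityUniformBounds_confinement_rhs_neg {a b m : ℝ} (hb : 0 ≤ b)
    (hm : a ^ 2 / 4 + b < m) : -2 * m + a * Real.sqrt m + b < 0 := by
  have hm0 : 0 ≤ m := by nlinarith [sq_nonneg a]
  have hsq : Real.sqrt m ^ 2 = m := Real.sq_sqrt hm0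
  nlinarith [sq_nonneg (Real.sqrt m - a / 2), Real.sqrt_nonneg m]

/-- **Confinement comparison (derivative form; registered sub-goal).** If `m` is continuous on `[t₀, ∞)` and
at every `t > t₀` has a derivative `D ≤ −2m(t) + a√(m(t)) + b` with `b ≥ 0`, then
`m t ≤ max (m t₀) (a²/4 + b)` for all `t ≥ t₀` — the real-variable step of the moment bound
(`d/dt ∫∫y²|ω| ≤ −2∫∫y²|ω| + 2∫∫ y v|ω| + 2ν∫∫|ω|`). [folklore] -/
theorem stub_vorticityUniformBounds_confinement : ∀ (a b t₀ : ℝ) (m : ℝ → ℝ), 0 ≤ b →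
    ContinuousOn m (Ici t₀) →
    (∀ t : ℝ, t₀ < t → ∃ D : ℝ, HasDerivAt m D t ∧ D ≤ -2 * m t + a * Real.sqrt (m t) + b) →
      ∀ t : ℝ, t₀ ≤ t → m t ≤ max (m t₀) (a ^ 2 / 4 + b) := by
  intro a b t₀ m hb hcont hderiv t ht
  refine stub_vorticityUniformBounds_barrier_of_hasDerivAt hcont (fun s hs hK => ?_) ht
  obtain ⟨D, hD, hle⟩ := hderiv s hs
  exact ⟨D, hD, hle.trans_lt (stub_vorticityUniformBounds_confinement_rhs_neg hb hK)⟩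

/-- **Confinement comparison (integral form).** If `m` is continuous on `[t₀, ∞)` and
`m t − m s ≤ ∫ₛᵗ (−2m + a√m + b)` for `t₀ < s < t`, with `b ≥ 0`, then `m t ≤ max (m t₀) (a²/4 + b)` for
`t ≥ t₀`. [folklore] -/
theorem stub_vorticityUniformBounds_confinement_integral {a b t₀ : ℝ} {m : ℝ → ℝ} (hb : 0 ≤ b)
    (hcont : ContinuousOn m (Ici t₀))
    (hint : ∀ s t : ℝ, t₀ < s → s < t →
      m t - m s ≤ ∫ r in s..t, (-2 * m r + a * Real.sqrt (m r) + b)) {t : ℝ} (ht : t₀ ≤ t) :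
    m t ≤ max (m t₀) (a ^ 2 / 4 + b) := by
  refine stub_vorticityUniformBounds_barrier_of_integral hcont ?_ hint
    (fun s _ hK => stub_vorticityUniformBounds_confinement_rhs_neg hb hK) ht
  exact ((continuousOn_const.mul hcont).add
    (continuousOn_const.mul (Real.continuous_sqrt.comp_continuousOn hcont))).add continuousOn_const

end Summit.AnomalousDissipation.AnomalousDissipation.Theorems.StrainedLayerLaw.StrainWorkSumRule

end
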